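import Summits.AtomisticToContinuum.Crystallization.Theorems.ChartedZeroExcessLayeredLatticeLiouvilleXO

/-!
# Zero-excess layered lattice Liouville — part XP (lens-2 g59, node «SBGlueC4d»): the two BUDGETS a level feeds into the step — FAR (all radii `ρ ≥ τ_ℓ`) and HISTORY

Critic rows 1133/1135 (C3 «what feeds `Θ` at the top scale», C4 «the history term»), leaf (2) `SubWindowBudgetGlueBPG` of `stmt-AtomisticToContinuum-26636`.

* XP.1 monotonicity of the dictionary / comparison-error constants in the certificate constants (`dictA` is antitone in `c`; `compErr` is monotone in
  `dA, dAϱ, δ_*`), so that every level's comparison error is measured with the FLOOR constants `K.dA, K.dAϱ, K.δs`.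
* XP.2 ★ `TowerInv.far` — the FAR-FIELD BUDGET of level `ℓ` for EVERY radius `ρ ≥ τ_ℓ`:
  `bondEnergy (S ∩ B(x, ρ)) (p − Ψ_ℓ p) ≤ Θ_ℓ·(ρ/τ_ℓ)·nK(S ∩ B(x, ρ))`, `Θ_ℓ = Θa + Θb/n_ℓ²`.  Regime (i) `(2ρ+8)(8/c₀) ≤ n₀`: the deepest level
  `i⋆ ≤ ℓ` whose ball covers `B(x, ρ)` (`n_{i⋆} ≤ 24ρ/(c₀ t_C)`), XL `bondEnergy_disp_iterate_le_of_cover` + the profile bound `p_{i⋆} ≤ P₀ + G₀/n_ℓ²` + the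
  mass comparison `#B_{n_{i⋆}} ≤ const·nK(S ∩ B(x,ρ))`; regime (ii) `n₀ < (2ρ+8)(8/c₀)` (so `R < 24 K_R ρ/c₀`): the global registration at depth
  `D = 8R + ρ` (XL `bondEnergy_disp_iterate_le_of_isGlobalReg`, `D/R ≤ 9ρ/τ_ℓ`, `nK(atomsIn D) ≤ const·nK(S ∩ B(x,ρ))`).  Both land in `OK.hΘa'`, `OK.hΘb'`.
* XP.3 ★ `TowerInv.hist` — the HISTORY BOUND of the comparison window: `E(φ_ℓ)(B_{m_w(ℓ)}) ≤ Rhist·(2p_π + 54Δ²)·#B_{n_{ℓ+1}}` with the PARENT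
  `π = ℓ − k₀` (recent drift `Δ = D_ℓ − D_π ≤ 2k₀√(Cm·p_{ℓ+1}/θ₁^{k₀+1})`, `p_π ≤ p_{ℓ+1}/θ₁^{k₀+1}`), or the top registration when `ℓ < k₀`.
-/

noncomputable section

open scoped BigOperators InnerProductSpace RealInnerProductSpace
open Set Function Metric
open Summit.AtomisticToContinuum.Crystallization.Theorems.ChartedPlanarOrderRigidityDoor (E3 IsClean IsNash atomsIn)
open Summit.AtomisticToContinuum.Crystallization.Theorems.ChartedPlanarOrderDensityDichotomy (μS IsSep nK nK_nonneg)
open Summit.AtomisticToContinuum.Crystallization.Theorems.ChartedPlanarOrderCleanScaleP (IsCleanP IsDoorSetP isCleanP_one_iff)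
open Summit.AtomisticToContinuum.Crystallization.Theorems.ChartedPlanarOrderMesoCut (LayeredHom)
open Summit.AtomisticToContinuum.Crystallization.Theorems.ChartedPlanarOrderDoorLayered (Layered layeredHom_eq_layered atomsIn_subset)
open Summit.AtomisticToContinuum.Crystallization.Theorems.ChartedPlanarOrderDoorLayeredOsc (IsTwoShellAffineGood)

namespace Summit.AtomisticToContinuum.Crystallization.Theorems.ChartedZeroExcessLayeredLatticeLiouville

/-! ### XP.1  Monotonicity of the constants -/

/-- `dictA` is antitone in the crystal constant. -/
theorem dictA_anti {c c' D : ℝ} (hc' : 0 < c') (hcc : c' ≤ c) (hD : 0 ≤ D) : dictA c D ≤ dictA c' D := by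
  unfold dictA
  have h1 : D / (2 * c) ≤ D / (2 * c') := div_le_div_of_nonneg_left hD (by positivity) (by linarith)
  have h2 : (⌈D / (2 * c)⌉₊ : ℝ) ≤ (⌈D / (2 * c')⌉₊ : ℝ) := by exact_mod_cast Nat.ceil_mono h1
  have h3 : (0 : ℝ) ≤ (⌈D / (2 * c)⌉₊ : ℝ) := by positivity
  gcongr

/-- `compErr` is monotone in the dictionary constants and the coherence slack. -/
theorem compErr_mono {κ₁ dA dA' dAϱ dAϱ' CT δs δs' εf AT F Em : ℝ} (hdA : 0 ≤ dA) (hdA' : dA ≤ dA') (hdAϱ : 0 ≤ dAϱ) (hdAϱ' : dAϱ ≤ dAϱ')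
    (hCT : 0 ≤ CT) (hδs : 0 ≤ δs) (hδs' : δs ≤ δs') (hF : 0 ≤ F) (hEm : 0 ≤ Em) :
    compErr κ₁ dA dAϱ CT δs εf AT F Em ≤ compErr κ₁ dA' dAϱ' CT δs' εf AT F Em := by
  unfold compErr
  have h1 : 0 ≤ 1 / 2 * CT * δs * dAϱ := by positivity
  have h2 : 0 ≤ 1 / 2 * CT * δs' := by have : 0 ≤ δs' := hδs.trans hδs'; positivity
  gcongr

/-- the last index `i ≤ ℓ` of an initial run of `P`: `P i` and (`i = ℓ` or `¬ P (i+1)`). [formal bookkeeping] -/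
theorem exists_last_le {P : ℕ → Prop} (h0 : P 0) (ℓ : ℕ) : ∃ i, i ≤ ℓ ∧ P i ∧ (i = ℓ ∨ ¬ P (i + 1)) := by
  induction ℓ with
  | zero => exact ⟨0, le_rfl, h0, Or.inl rfl⟩
  | succ ℓ ih =>
    obtain ⟨i, hi, hP, hor⟩ := ih
    by_cases hnext : P (i + 1)
    · rcases hor with rfl | hnot
      · exact ⟨i + 1, le_rfl, hnext, Or.inl rfl⟩
      · exact (hnot hnext).elim
    · exact ⟨i, Nat.le_succ_of_le hi, hP, Or.inr hnext⟩

namespace SBK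

variable {K : SBK}

/-- `n_add` (docstring added by the landing lane; see the module docstring). [formal bookkeeping] -/
theorem n_add (K : SBK) (i j : ℕ) : K.n (i + j) = K.n i * K.tC ^ j := by unfold SBK.n; rw [pow_add]; ring

/-- `dA_nonneg` (docstring added by the landing lane; see the module docstring). [formal bookkeeping] -/
theorem dA_nonneg (K : SBK) : 0 ≤ K.dA := dictA_nonneg _ _
/-- `dAϱ_nonneg` (docstring added by the landing lane; see the module docstring). [formal bookkeeping] -/
theorem dAϱ_nonneg (K : SBK) : 0 ≤ K.dAϱ := dictA_nonneg _ _
/-- `δs_nonneg` (docstring added by the landing lane; see the module docstring). [formal bookkeeping] -/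
theorem δs_nonneg (hK : K.OK) : 0 ≤ K.δs := by
  unfold SBK.δs; have := hK.hϱ; have := hK.hc₀; have := C₁_pos hK; have := hK.hω₁; have := hK.hϑ₁; have := hK.hμM; positivity

/-- the comparison window of a level on the tower is inside `Kw·n_ℓ ≤ Kw·n₀`. -/
theorem mw_le (hK : K.OK) {ℓ : ℕ} (hℓ : K.nlo ≤ K.n ℓ) : K.mw ℓ ≤ K.Kw * K.n ℓ ∧ K.Kw * K.n ℓ ≤ K.Kw * K.n0 := by
  have h1 := hK.hnlom; have h2 := hK.hKw; have hc := hK.hc₀; have hn := n_pos hK ℓ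
  have h3 : K.n ℓ ≤ K.n0 := by rw [← n_zero]; exact n_anti hK (Nat.zero_le ℓ)
  refine ⟨?_, mul_le_mul_of_nonneg_left h3 (zero_le_one.trans (one_le_Kw hK))⟩
  unfold SBK.mw SBK.τ SBK.t
  have e : (2 * (2 * (7 * K.C₁ * K.n ℓ + 8 * K.ϱ + 10)) + 8) * (18 / K.c₀) + K.n ℓ + 2 * K.ϱ / K.c₀ + 1 =
      504 * K.C₁ / K.c₀ * K.n ℓ + K.n ℓ + ((32 * K.ϱ + 48) * (18 / K.c₀) + 2 * K.ϱ / K.c₀ + 1) := by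
    field_simp; ring
  rw [e]
  linarith [mul_le_mul_of_nonneg_right h2 hn.le]

/-- `mw_nonneg` (docstring added by the landing lane; see the module docstring). [formal bookkeeping] -/
theorem mw_nonneg (hK : K.OK) (ℓ : ℕ) : 0 ≤ K.mw ℓ := by
  unfold SBK.mw SBK.τ; have := (t_ge hK ℓ).2; have := hK.hc₀; have := hK.hϱ; have := n_pos hK ℓ; positivity

end SBK

/-! ### XP.2  The far-field budget of a level -/

section Budgets

variable {K : SBK} {S : Set E3} {Ψ₀ : E3 → E3} {st₀ : Lev} {x : E3} {X₀ : Cell 2 × ℤ} {ℓ : ℕ} {lev : ℕ → Lev}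

/-- regime (i) of the far budget: a covering level exists. -/
theorem TowerInv.far_cover (T : TH K S Ψ₀ st₀ x X₀) (hT : TowerInv K S Ψ₀ st₀ X₀ ℓ lev) (hℓ : K.nlo ≤ K.n ℓ) {ρ : ℝ}
    (hρ : K.τ ℓ ≤ ρ) (hA : (2 * ρ + 8) * (8 / K.c₀) ≤ K.n 0) :
    bondEnergy (S ∩ ball x ρ) (fun p => p - levΨ Ψ₀ st₀ (lev ℓ) p) ≤ (K.Θa + K.Θb / K.n ℓ ^ 2) * nK (S ∩ ball x ρ) := by
  have hK := T.ok
  obtain ⟨-, h18⟩ := SBK.t_ge hK ℓ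
  have hτ : K.τ ℓ = 2 * K.t ℓ := rfl
  have hρ21 : (21 : ℝ) ≤ ρ := by linarith
  have hc := hK.hc₀; have ht := hK.htC; have hC₁ := SBK.C₁_pos hK
  obtain ⟨i₀, hi₀ℓ, hPi, hmax⟩ := exists_last_le (P := fun i => (2 * ρ + 8) * (8 / K.c₀) ≤ K.n i) hA ℓ
  have hniℓ : K.n ℓ ≤ K.n i₀ := SBK.n_anti hK hi₀ℓ
  have hnlo_i : K.nlo ≤ K.n i₀ := hℓ.trans hniℓ
  -- the covering level is not too coarse
  have hni : K.n i₀ ≤ 24 / (K.c₀ * K.tC) * ρ := by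
    rw [div_mul_eq_mul_div, le_div_iff₀ (by positivity)]
    rcases hmax with heq | hnP
    · rw [heq]
      have h0 : 0 ≤ K.C₁ * K.n ℓ := by have := SBK.n_pos hK ℓ; positivity
      have h1 : 7 * K.C₁ * K.n ℓ ≤ ρ := by have := hK.hϱ; unfold SBK.τ SBK.t at hρ; linarith
      have h2 : K.c₀ * K.tC ≤ K.C₁ * 1 := mul_le_mul hK.hcC (SBK.tC_le_one hK) ht.le hC₁.le
      have h3 := mul_le_mul_of_nonneg_left h2 (SBK.n_pos hK ℓ).le
      linarith
    · rw [not_le, SBK.n_succ] at hnP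
      have h1 : K.c₀ * (K.tC * K.n i₀) ≤ K.c₀ * ((2 * ρ + 8) * (8 / K.c₀)) := mul_le_mul_of_nonneg_left hnP.le hc.le
      have h2 : K.c₀ * ((2 * ρ + 8) * (8 / K.c₀)) = 16 * ρ + 64 := by field_simp; ring
      linarith
  have hOi := hT.levOK i₀ hi₀ℓ
  have hOℓ := hT.levOK ℓ le_rfl
  obtain ⟨hlip, hDle⟩ := hT.lip ℓ le_rfl i₀ hi₀ℓ
  have hcov := bondEnergy_disp_iterate_le_of_cover T.cleanP T.bij₀ T.c₀_pos T.cryst₀ T.fwd₀ T.hδ T.sep (hOi.c_pos T hnlo_i) hOi.cryst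
    (hOℓ.c_pos T hℓ) hOℓ.cryst hlip X₀ (by linarith : (0 : ℝ) ≤ ρ) hPi
  rw [T.hX₀] at hcov
  rw [levΨ_def]
  refine hcov.trans ?_
  -- the profile bound of the covering level and the drift bound
  have hE := hOi.energy
  rw [levφ_def] at hE
  set Nb : ℝ := ((idxBall X₀ (K.n i₀)).ncard : ℝ)
  have hNb : 0 ≤ Nb := by positivity
  have hpi : K.p i₀ ≤ K.P₀ + K.G₀ / K.n ℓ ^ 2 := by
    unfold SBK.p
    have h1 : K.θ₁ ^ i₀ ≤ 1 := pow_le_one₀ (SBK.θ₁_nonneg hK) (by linarith [SBK.θ₁_le hK])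
    have h2 : K.G₀ / K.n i₀ ^ 2 ≤ K.G₀ / K.n ℓ ^ 2 :=
      div_le_div_of_nonneg_left hK.hG₀ (by have := SBK.n_pos hK ℓ; positivity) (pow_le_pow_left₀ (SBK.n_pos hK ℓ).le hniℓ 2)
    have h3 := mul_le_mul_of_nonneg_left h1 hK.hP₀
    linarith
  obtain ⟨-, -, -, -, -, hD2, -⟩ := hOℓ.floors T hℓ
  have hΔ0 : 0 ≤ (lev ℓ).D - (lev i₀).D := by linarith
  have hΔ : ((lev ℓ).D - (lev i₀).D) ^ 2 ≤ (2 * K.μM) ^ 2 := pow_le_pow_left₀ hΔ0 (by linarith [hOi.D0]) 2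
  have hmass := ncard_idxBall_le_mass T.bij₀ T.iso T.clean₀ T.tame₀ T.c₀_pos T.cryst₀ T.hδ T.sep hC₁ X₀ hρ21 (SBK.one_le_n hK hnlo_i) hni
  rw [T.hX₀] at hmass
  set N : ℝ := nK (S ∩ ball x ρ)
  set α : ℝ := dictA K.c₀ 8 * (27 * (336 * K.C₁ * (24 / (K.c₀ * K.tC)) / 25) ^ 3) with hα
  have hdA8 : 0 ≤ dictA K.c₀ 8 := dictA_nonneg _ _
  have hα0 : 0 ≤ α := by positivity
  -- step 1: substitute the profile and drift bounds
  have s1 : dictA K.c₀ 8 * (2 * idxEnergy (pullDisp S (transReg Ψ₀ (chartGen₁ st₀.L) (chartGen₂ st₀.L) st₀.w₁ (chartGen₁ (lev i₀).L)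
      (chartGen₂ (lev i₀).L) (lev i₀).w₁) (chartGen₁ (lev i₀).L) (chartGen₂ (lev i₀).L) (lev i₀).w₁) (idxBall X₀ (K.n i₀)) +
      54 * ((lev ℓ).D - (lev i₀).D) ^ 2 * Nb) ≤ dictA K.c₀ 8 * ((2 * (K.P₀ + K.G₀ / K.n ℓ ^ 2) + 54 * (2 * K.μM) ^ 2) * Nb) := by
    refine mul_le_mul_of_nonneg_left ?_ hdA8
    have h1 : K.p i₀ * Nb ≤ (K.P₀ + K.G₀ / K.n ℓ ^ 2) * Nb := mul_le_mul_of_nonneg_right hpi hNb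
    have h2 : ((lev ℓ).D - (lev i₀).D) ^ 2 * Nb ≤ (2 * K.μM) ^ 2 * Nb := mul_le_mul_of_nonneg_right hΔ hNb
    linarith
  refine s1.trans ?_
  -- step 2: the mass comparison `Nb ≤ 27(…)³ N`
  have hcoef : 0 ≤ 2 * (K.P₀ + K.G₀ / K.n ℓ ^ 2) + 54 * (2 * K.μM) ^ 2 := by
    have := hK.hP₀; have := hK.hG₀; have := SBK.n_pos hK ℓ; positivity
  have s2 : dictA K.c₀ 8 * ((2 * (K.P₀ + K.G₀ / K.n ℓ ^ 2) + 54 * (2 * K.μM) ^ 2) * Nb) ≤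
      α * (2 * K.P₀ + 54 * (2 * K.μM) ^ 2) * N + α * (2 * K.G₀) / K.n ℓ ^ 2 * N := by
    have h1 := mul_le_mul_of_nonneg_left hmass (mul_nonneg hdA8 hcoef)
    have e : dictA K.c₀ 8 * (2 * (K.P₀ + K.G₀ / K.n ℓ ^ 2) + 54 * (2 * K.μM) ^ 2) *
        (27 * (336 * K.C₁ * (24 / (K.c₀ * K.tC)) / 25) ^ 3 * N) =
        α * (2 * K.P₀ + 54 * (2 * K.μM) ^ 2) * N + α * (2 * K.G₀) / K.n ℓ ^ 2 * N := by rw [hα]; ring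
    linarith [h1, e]
  refine s2.trans ?_
  -- step 3: `OK.hΘa'`, `OK.hΘb'`
  have hN : 0 ≤ N := nK_nonneg _
  have h3 := hK.hΘa'
  have h4 := hK.hΘb'
  have hX : 0 ≤ 2 * (10 / K.δ + 1) ^ 3 * (9 * K.Cg * K.η) * ((2 * (192 * K.KR / K.c₀ + 2) / K.δ + 1 / 21) * (336 * K.C₁ / 25)) ^ 3 := by
    have := T.hδ; have := hK.hCg; have := hK.hη; have := hK.hKR; positivity
  have hY : 0 ≤ 2 * ((2 * K.μM) * (8 / K.c₀)) ^ 2 * (10 / K.δ + 1) ^ 3 := by have := T.hδ; positivity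
  have h5 : α * (2 * K.P₀ + 54 * (2 * K.μM) ^ 2) ≤ K.Θa := by rw [hα]; linarith
  have h6 : α * (2 * K.G₀) / K.n ℓ ^ 2 ≤ K.Θb / K.n ℓ ^ 2 := by
    rw [hα]; exact div_le_div_of_nonneg_right h4 (by positivity)
  calc α * (2 * K.P₀ + 54 * (2 * K.μM) ^ 2) * N + α * (2 * K.G₀) / K.n ℓ ^ 2 * N
      ≤ K.Θa * N + K.Θb / K.n ℓ ^ 2 * N := add_le_add (mul_le_mul_of_nonneg_right h5 hN) (mul_le_mul_of_nonneg_right h6 hN)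
    _ = (K.Θa + K.Θb / K.n ℓ ^ 2) * N := by ring

/-- regime (ii) of the far budget: no covering level; the global registration at depth `8R + ρ`. -/
theorem TowerInv.far_reg (T : TH K S Ψ₀ st₀ x X₀) (hT : TowerInv K S Ψ₀ st₀ X₀ ℓ lev) (hℓ : K.nlo ≤ K.n ℓ) {ρ : ℝ}
    (hρ : K.τ ℓ ≤ ρ) (hA : K.n 0 < (2 * ρ + 8) * (8 / K.c₀)) :
    bondEnergy (S ∩ ball x ρ) (fun p => p - levΨ Ψ₀ st₀ (lev ℓ) p) ≤ K.Θa * (ρ / K.τ ℓ) * nK (S ∩ ball x ρ) := by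
  have hK := T.ok
  obtain ⟨-, h18⟩ := SBK.t_ge hK ℓ
  have hτ : K.τ ℓ = 2 * K.t ℓ := rfl
  have hτpos : 0 < K.τ ℓ := by linarith
  have hρ21 : (21 : ℝ) ≤ ρ := by linarith
  have hc := hK.hc₀; have hC₁ := SBK.C₁_pos hK; have hKR := hK.hKR
  have hRpos : 0 < K.R := by linarith [hK.hR]
  -- `R < 24 K_R ρ / c₀`
  rw [SBK.n_zero] at hA
  unfold SBK.n0 at hA
  rw [div_lt_iff₀ hKR] at hA
  have hR24 : K.R * K.c₀ ≤ 24 * K.KR * ρ := by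
    have h1 : K.R * K.c₀ < (2 * ρ + 8) * (8 / K.c₀) * K.KR * K.c₀ := mul_lt_mul_of_pos_right hA hc
    have e : (2 * ρ + 8) * (8 / K.c₀) * K.KR * K.c₀ = (16 * ρ + 64) * K.KR := by field_simp; ring
    rw [e] at h1
    have h2 : 0 ≤ K.KR * (ρ - 8) := mul_nonneg hKR.le (by linarith)
    linarith
  have hR' : K.R ≤ 24 * K.KR * ρ / K.c₀ := by rw [le_div_iff₀ hc]; exact hR24
  have hOℓ := hT.levOK ℓ le_rfl
  obtain ⟨hlip0, -⟩ := hT.lip ℓ le_rfl 0 (Nat.zero_le ℓ)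
  rw [hT.zero, T.D₀, sub_zero] at hlip0
  have hsub : S ∩ ball x ρ ⊆ atomsIn (μS S) 0 (8 * K.R + ρ) := inter_ball_subset_atomsIn (by linarith [T.xR.le])
  have hfar := bondEnergy_disp_iterate_le_of_isGlobalReg T.bij₀ T.c₀_pos T.cryst₀ T.hδ T.sep T.reg' hOℓ.D0 hlip0
    (show K.R ≤ 8 * K.R + ρ by linarith) hsub
  rw [levΨ_def]
  refine hfar.trans ?_
  have hmass := nK_atomsIn_le_mass T.bij₀ T.iso T.clean₀ T.tame₀ T.c₀_pos T.cryst₀ T.hδ T.sep hC₁ X₀ hρ21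
    (show (0 : ℝ) ≤ 8 * K.R + ρ by linarith) (B := 192 * K.KR / K.c₀ + 2)
    (by have : 192 * K.KR / K.c₀ * ρ = 8 * (24 * K.KR * ρ / K.c₀) := by ring
        nlinarith)
  rw [T.hX₀] at hmass
  have h3 := hK.hΘa'
  set N : ℝ := nK (S ∩ ball x ρ)
  have hN : 0 ≤ N := nK_nonneg _
  set M3 : ℝ := ((2 * (192 * K.KR / K.c₀ + 2) / K.δ + 1 / 21) * (336 * K.C₁ / 25)) ^ 3
  -- `D/R ≤ 9ρ/τ`
  have hDR : (8 * K.R + ρ) / K.R ≤ 9 * (ρ / K.τ ℓ) := by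
    have h1 : (8 * K.R + ρ) / K.R = 8 + ρ / K.R := by field_simp
    have h2 : ρ / K.R ≤ ρ / K.τ ℓ := div_le_div_of_nonneg_left (by linarith) hτpos (SBK.τ_le_R hK ℓ)
    have h3 : 1 ≤ ρ / K.τ ℓ := by rw [le_div_iff₀ hτpos]; linarith
    linarith
  have hδ := T.hδ
  have hq : 0 ≤ (10 / K.δ + 1) ^ 3 := by positivity
  have hCgη : 0 ≤ K.Cg * K.η := by have := hK.hCg; have := hK.hη; positivity
  -- term 1
  have s1 : 2 * ((10 / K.δ + 1) ^ 3 * (K.Cg * ((8 * K.R + ρ) / K.R) * K.η * nK (atomsIn (μS S) 0 (8 * K.R + ρ)))) ≤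
      2 * (10 / K.δ + 1) ^ 3 * (9 * K.Cg * K.η) * M3 * (ρ / K.τ ℓ) * N := by
    have h1 : K.Cg * ((8 * K.R + ρ) / K.R) * K.η ≤ K.Cg * (9 * (ρ / K.τ ℓ)) * K.η := by
      have := mul_le_mul_of_nonneg_left hDR hCgη
      linarith
    have h2 : 0 ≤ K.Cg * ((8 * K.R + ρ) / K.R) * K.η := by have := hK.hCg; have := hK.hη; positivity
    have h3 := mul_le_mul h1 hmass (nK_nonneg _) (by have := hK.hCg; have := hK.hη; positivity)
    have h4 := mul_le_mul_of_nonneg_left h3 (mul_nonneg (by norm_num : (0 : ℝ) ≤ 2) hq)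
    have e : 2 * (10 / K.δ + 1) ^ 3 * (K.Cg * (9 * (ρ / K.τ ℓ)) * K.η * (M3 * N)) =
        2 * (10 / K.δ + 1) ^ 3 * (9 * K.Cg * K.η) * M3 * (ρ / K.τ ℓ) * N := by ring
    linarith [h4, e]
  -- term 2
  obtain ⟨-, -, -, -, -, hD2, -⟩ := hOℓ.floors T hℓ
  have s2 : 2 * (((lev ℓ).D * (8 / K.c₀)) ^ 2 * ((10 / K.δ + 1) ^ 3 * N)) ≤ 2 * ((2 * K.μM) * (8 / K.c₀)) ^ 2 * (10 / K.δ + 1) ^ 3 * (ρ / K.τ ℓ) * N := by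
    have h1 : ((lev ℓ).D * (8 / K.c₀)) ^ 2 ≤ ((2 * K.μM) * (8 / K.c₀)) ^ 2 :=
      pow_le_pow_left₀ (by have := hOℓ.D0; positivity) (by gcongr) 2
    have h3 : 1 ≤ ρ / K.τ ℓ := by rw [le_div_iff₀ hτpos]; linarith
    have h4 : 0 ≤ ((2 * K.μM) * (8 / K.c₀)) ^ 2 * (10 / K.δ + 1) ^ 3 * N := by have := hK.hμM; positivity
    have t1 := mul_le_mul_of_nonneg_right h1 (mul_nonneg hq hN)
    have t2 := mul_le_mul_of_nonneg_left h3 h4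
    linarith
  have hαp : 0 ≤ dictA K.c₀ 8 * (27 * (336 * K.C₁ * (24 / (K.c₀ * K.tC)) / 25) ^ 3) * (2 * K.P₀ + 54 * (2 * K.μM) ^ 2) := by
    have := dictA_nonneg K.c₀ 8; have := hK.htC; have := hK.hP₀; positivity
  have h5 : 2 * (10 / K.δ + 1) ^ 3 * (9 * K.Cg * K.η) * M3 + 2 * ((2 * K.μM) * (8 / K.c₀)) ^ 2 * (10 / K.δ + 1) ^ 3 ≤ K.Θa := by linarith
  have hρτ : 0 ≤ ρ / K.τ ℓ := by positivity
  have h6 := mul_le_mul_of_nonneg_right (mul_le_mul_of_nonneg_right h5 hρτ) hN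
  linarith

/-- ★ the FAR-FIELD BUDGET of a level for every radius `ρ ≥ τ_ℓ` (module docstring XP.2). [this file, g59] -/
theorem TowerInv.far (T : TH K S Ψ₀ st₀ x X₀) (hT : TowerInv K S Ψ₀ st₀ X₀ ℓ lev) (hℓ : K.nlo ≤ K.n ℓ) :
    ∀ ρ : ℝ, K.τ ℓ ≤ ρ → bondEnergy (S ∩ ball x ρ) (fun p => p - levΨ Ψ₀ st₀ (lev ℓ) p) ≤ K.Θ ℓ * (ρ / K.τ ℓ) * nK (S ∩ ball x ρ) := by
  intro ρ hρ
  have hK := T.ok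
  obtain ⟨-, h18⟩ := SBK.t_ge hK ℓ
  have hτ : K.τ ℓ = 2 * K.t ℓ := rfl
  have hρτ : 1 ≤ ρ / K.τ ℓ := by rw [le_div_iff₀ (by linarith)]; linarith
  have hN := nK_nonneg (S ∩ ball x ρ)
  have hΘa := hK.hΘa; have hΘb := hK.hΘb
  have hn := SBK.n_pos hK ℓ
  have hb : 0 ≤ K.Θb / K.n ℓ ^ 2 := by positivity
  unfold SBK.Θ
  rcases le_or_gt ((2 * ρ + 8) * (8 / K.c₀)) (K.n 0) with hA | hA
  · have h := hT.far_cover T hℓ hρ hA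
    have h2 := mul_le_mul_of_nonneg_left hρτ (mul_nonneg (add_nonneg hΘa hb) hN)
    linarith
  · have h := hT.far_reg T hℓ hρ hA
    have h2 : 0 ≤ K.Θb / K.n ℓ ^ 2 * (ρ / K.τ ℓ) * nK (S ∩ ball x ρ) := by positivity
    linarith

end Budgets

end Summit.AtomisticToContinuum.Crystallization.Theorems.ChartedZeroExcessLayeredLatticeLiouville

end
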